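import Summits.ResolutionOfSingularities.ResolutionOfSingularities.Theorems.FrobeniusLadderFInjectiveMacaulayficationOfLocalDoorAdm
import Summits.ResolutionOfSingularities.ResolutionOfSingularities.Theorems.FrobeniusLadderFInjectiveMacaulayficationLocalMacaulayficationOfFactOffClosed
import HarnessLib

/-!
# DOOR v37's `_proof` term under the WEAKER fact text (B): the crux ⟸ {CP 1.1, R–G 081R, CP 4.4} ∧ [Česnavičius 2021 Thm. 5.3, W-supported reading]
# ∧ (LR_adm) ∧ (LF_adm-F)
# (crux `FInjectiveMacaulayfication` stmt-ResolutionOfSingularities-15315, chain w45a; programme «CZ», the (B)-twin of res-L1-w45a-stub-1's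
# `OfLocalDoorAdm.fInjectiveMacaulayfication_of_localDoorAdm_of_fact` (p594133, text (A)); seat res-L1-w45a-stub-2 g6)

[OURS · L1 W4.5a] Support file (`--supports stmt-ResolutionOfSingularities-15315 --as helper`); NOT a statement of any manuscript; def-free; CONDITIONAL on
the three printed theorems BY NAME, on ONE printed result taken as the BINDER `hM` (text (B) = `CesnaviciusBlowupMacaulayficationOffClosed`, HOME
`L/res-L1-w45a-stub-2/MacaulayficationBlowupFormSupported.lean` sha16 4b38abcc4649efc5: for `Y` integral Noetherian excellent and a closed `W` off which
`Y` is Cohen–Macaulay, a blowing up with centre supported in `W` and Cohen–Macaulay total space — a direct consequence of [Česnavičius 2021, Thm. 5.3]),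
and on the two CANDIDATE local statements (LR_adm) `RegularOffFiniteOfLRAdm.LocalResolutionNonClosedGe4Adm` and (LF_adm-F)
`LocalFullificationFibreAdmGe4Split.LocalFInjectivizationFibreAdmGe4`. AI-written (AI review is weaker than expert review).

* **`fInjectiveMacaulayfication_of_localDoorAdm_of_factOffClosed (hG h081R hP) (hM) (hLR_adm) (hF) : Theses.FrobeniusLadder.FInjectiveMacaulayfication`**
  — so that door v37 registers with `_proof` ONE TOKEN whichever of the two candidate Literature texts ((A) bf2f9b4cfcfbf1d7 / (B) 4b38abcc4649efc5)
  the desk admits: (A) → p594133, (B) → this file.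
[folklore assembly; cite: Cesnavicius2021, Thm. 5.3] [cite: CossartPiltant2019, Thm. 1.1 (i)(ii); Prop. 4.4] [cite: RaynaudGruson1971, Thm. 5.2.2]
[cite: Temkin2008, Prop. 2.3.4 (iii)]
-/

-- single-problem summit: the doubled namespace component is forced
set_option linter.dupNamespace false

noncomputable section

namespace Summit.ResolutionOfSingularities.ResolutionOfSingularities.Theorems.FInjectiveMacaulayfication.OfLocalDoorAdmFactOffClosed

open CategoryTheory CategoryTheory.Limits AlgebraicGeometry TopologicalSpace IsLocalRing
open Literature.AlgebraicGeometry.Resolution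
open Summit.ResolutionOfSingularities.ResolutionOfSingularities.Theorems.FInjectiveMacaulayfication
open SliceableCentre

/-- **★ THE ROUTE DECL FROM {CP 1.1, 081R, CP 4.4} ∧ [Česnavičius 5.3, reading (B), as a binder] ∧ (LR_adm) ∧ (LF_adm-F)** — door v37's `_proof` term
under text (B). [OURS · conditional-result] [cite: Cesnavicius2021, Thm. 5.3] [cite: CossartPiltant2019, Thm. 1.1 (i)(ii); Prop. 4.4]
[cite: Temkin2008, Prop. 2.3.4 (iii)] -/
theorem fInjectiveMacaulayfication_of_localDoorAdm_of_factOffClosed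
    (hG : CossartPiltant2019General.{0}) (h081R : Stacks081R.{0}) (hP : CossartPiltant2019Principalization.{0})
    (hM : ∀ (Y : Scheme.{0}) [IsIntegral Y] [IsNoetherian Y], Scheme.IsExcellent Y →
      ∀ W : Set Y, IsClosed W →
        (∀ y : Y, y ∉ W → ∀ d : ℕ, ringKrullDim (Y.presheaf.stalk y) = d →
            ∀ s : Fin d → Y.presheaf.stalk y, (Ideal.span (Set.range s)).radical.IsMaximal →
              RingTheory.Sequence.IsWeaklyRegular (Y.presheaf.stalk y) (List.ofFn s)) →
        ∃ Z : Y.IdealSheafData, (Z.support : Set Y) ⊆ W ∧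
          ∀ (Y' : Scheme.{0}) (π : Y' ⟶ Y), IsBlowup π Z →
            ∀ y' : Y', ∀ d : ℕ, ringKrullDim (Y'.presheaf.stalk y') = d →
              ∀ s : Fin d → Y'.presheaf.stalk y', (Ideal.span (Set.range s)).radical.IsMaximal →
                RingTheory.Sequence.IsWeaklyRegular (Y'.presheaf.stalk y') (List.ofFn s))
    (hLR : RegularOffFiniteOfLRAdm.LocalResolutionNonClosedGe4Adm)
    (hF : LocalFullificationFibreAdmGe4Split.LocalFInjectivizationFibreAdmGe4) :
    Summit.ResolutionOfSingularities.ResolutionOfSingularities.Theses.FrobeniusLadder.FInjectiveMacaulayfication :=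
  OfLocalDoorAdm.fInjectiveMacaulayfication_of_localDoorAdm hG h081R hP hLR
    (LocalMacaulayficationOfFactOffClosed.localFullificationFibreAdmGe4_of_factOffClosed_of_F hM hF)

end Summit.ResolutionOfSingularities.ResolutionOfSingularities.Theorems.FInjectiveMacaulayfication.OfLocalDoorAdmFactOffClosed

end
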